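import Literature.NumberTheory.Automorphic.GLnResiduallyRegularConjugacy        -- ★-pending (this seat, D-S3c (c2)(c3)(c5)): the orbit lemma in `glInt` tokens
import Literature.NumberTheory.Automorphic.ResiduallyRegularOrbitalIntegral      -- ★ (F0P3b-p01 (g5), D-S3i): `preimage_val_subset_compactCore`, the `hcore` binder shape
import Literature.NumberTheory.Automorphic.LocalOrbitalMeasure                  -- ★ `isClosed_coe_centralizer_singleton`
import Literature.NumberTheory.GaloisRepresentations.StableLatticeValuationRing  -- ★ Serre: `exists_conj_mem_range_generalLinearGroup_map_of_valuationSubring`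
import Mathlib.NumberTheory.LocalField.Basic
import HarnessLib

/-!
# The compact core of a residually regular centraliser IS its integral part: `G_γ ∩ GL_n(𝒪) = compactCore G_γ` — the binder `hcore` of
# ★ `ResiduallyRegularOrbitalIntegral`, discharged (Kottwitz 1986 Prop. 7.1; Tits 1979 §3.9; Serre's stable lattice)

Topic `NumberTheory/Automorphic`; namespace `Literature.NumberTheory.Automorphic.GLn`.  THEOREMS ONLY (no definition, no instance, no notation, no named
fact, no `sorry`; one `private` subgroup-product helper).  Cell `hodgecm-mathlib`, F0∕P3a road D-S, brick «D-S3c» part (c4) (LEAD F0P3a-plan (g8) T7-20 (C); seat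
B-p14 (g29)).

SETTING.  `E` a non-archimedean local field (Mathlib `IsNonarchimedeanLocalField`; `𝒪 = 𝒪[E]`), `γ ∈ GL_n(𝒪) ≤ GL_n(E)` (★ `glInt`) whose characteristic
polynomial is separable over `E` (`hγs`) with separable reduction (`hsep`, on ★ `IntegralReduction.redMat γ`), `Z(γ) = Subgroup.centralizer {γ}`.

* **`GLn.subgroup_le_glInt_of_isCompact_of_le_centralizer`** — every COMPACT subgroup `C ≤ GL_n(E)` centralising `γ` lies in `GL_n(𝒪)`.  THE ARGUMENT
  (that of ★ `CompactCoreCentralizerLevelOfIntegralConjugacy` §1, which is the number-field-completion special case with `γ` rational; here GENERIC over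
  a local field with `γ` local): `Z(γ)` is commutative (★ `commute_of_commute_map_of_charpoly_separable`), so `D := C · (GL_n(𝒪) ∩ Z(γ))` is a compact
  subgroup; Serre's stable lattice (★ `exists_conj_mem_range_generalLinearGroup_map_of_valuationSubring` at the open valuation ring `𝒪[E]`) gives `P` with
  `P⁻¹ D P ⊆ GL_n(𝒪)`, in particular `P⁻¹ γ P ∈ GL_n(𝒪)`, so by the orbit lemma ★ `GLn.mem_glInt_mul_centralizer_of_conj_mem_glInt` (D-S3c (c5))
  `P⁻¹ = k z` with `k ∈ GL_n(𝒪)`, `z ∈ Z(γ)`, and for `c ∈ C ⊆ Z(γ)`: `P⁻¹ c P = k c k⁻¹ ∈ GL_n(𝒪)`, hence `c ∈ GL_n(𝒪)`.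
* **`GLn.setOf_mem_glInt_eq_compactCore_centralizer`** — `{z ∈ Z(γ) | z ∈ GL_n(𝒪)} = compactCore Z(γ)`: the binder `hcore` of ★
  `GLn.classOrbitalIntegral_indicator_glInt_eq_one_of_isCanonical` ∕ `…_eq_of_isCanonical` ∕ `GLn.orbitalIntegral_indicator_glInt_eq_one_of_compactCore`
  (F0P3b-p01 (g5)) TOKEN FOR TOKEN — with ★ (c3) `GLn.forall_exists_mem_glInt_conj_eq_of_isConj` for `hK1`, the unit element `O_γ(1_K) = 1` at residually
  regular `γ` is now HYPOTHESIS-FREE.  «`T(𝒪_v)` is the maximal compact subgroup of the unramified torus `T = G_γ`» [Tits1979, §3.9; Rogawski1990, §4.3 p. 43].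

HC_CM is proved only modulo the printed citations until rung 0 closes; this file is count-neutral (D-S road, #88 K7-s inputs).

## References
* [Kottwitz1986] R. E. Kottwitz, *Stable trace formula: elliptic singular terms*, Math. Ann. 275 (1986), §7 Prop. 7.1.
* [Tits1979] J. Tits, *Reductive groups over local fields*, PSPM 33.1 (1979), §3.9.
* [SerreAbelianLadic1968] J.-P. Serre, *Abelian ℓ-adic representations and elliptic curves* (1968), Ch. I §1.1, Remark 1.
* [Rogawski1990] J. D. Rogawski, *Automorphic Representations of Unitary Groups in Three Variables* (1990), §4.3 p. 43.
-/

set_option autoImplicit false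

noncomputable section

open Matrix ValuativeRel Polynomial Topology
open scoped Matrix MatrixGroups ValuativeRel Pointwise

namespace Literature.NumberTheory.Automorphic.GLn

open Literature.LinearAlgebra.Matrix Literature.NumberTheory.Automorphic.IntegralReduction

universe u

/-- A subgroup whose carrier is the product `C · K′` of two subgroups whose elements commute pairwise (private copy of ★
`exists_subgroup_coe_eq_mul_of_forall_commute`, to keep the import closure local-field only). [folklore] -/
private theorem exists_subgroup_coe_eq_mul_of_forall_commute' {G : Type*} [Group G] (C K' : Subgroup G)
    (hcomm : ∀ a ∈ C, ∀ b ∈ K', a * b = b * a) : ∃ D : Subgroup G, (D : Set G) = (C : Set G) * (K' : Set G) := by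
  refine ⟨{ carrier := (C : Set G) * (K' : Set G), mul_mem' := ?_, one_mem' := ⟨1, C.one_mem, 1, K'.one_mem, mul_one 1⟩, inv_mem' := ?_ }, rfl⟩
  · rintro _ _ ⟨a, ha, b, hb, rfl⟩ ⟨a', ha', b', hb', rfl⟩
    refine ⟨a * a', C.mul_mem ha ha', b * b', K'.mul_mem hb hb', ?_⟩
    calc a * a' * (b * b') = a * (a' * b) * b' := by simp only [mul_assoc]
      _ = a * (b * a') * b' := by rw [hcomm a' ha' b hb]
      _ = a * b * (a' * b') := by simp only [mul_assoc]
  · rintro _ ⟨a, ha, b, hb, rfl⟩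
    refine ⟨a⁻¹, C.inv_mem ha, b⁻¹, K'.inv_mem hb, ?_⟩
    rw [_root_.mul_inv_rev, ← hcomm a⁻¹ (C.inv_mem ha) b⁻¹ (K'.inv_mem hb)]

variable {E : Type u} [Field E] [ValuativeRel E] [TopologicalSpace E] [IsNonarchimedeanLocalField E] {n : ℕ}

omit [ValuativeRel E] [TopologicalSpace E] [IsNonarchimedeanLocalField E] in
/-- The centraliser of an element of `GL_n(E)` with separable characteristic polynomial is commutative. [cite: Kottwitz1986, Prop. 7.1] -/
theorem mul_comm_of_mem_centralizer_of_charpoly_separable' {γ : GL (Fin n) E}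
    (hγs : ((γ : GL (Fin n) E) : Matrix (Fin n) (Fin n) E).charpoly.Separable)
    {a b : GL (Fin n) E} (ha : a ∈ Subgroup.centralizer ({γ} : Set (GL (Fin n) E)))
    (hb : b ∈ Subgroup.centralizer ({γ} : Set (GL (Fin n) E))) : a * b = b * a := by
  rw [Subgroup.mem_centralizer_singleton_iff] at ha hb
  have hmap : ((γ : GL (Fin n) E) : Matrix (Fin n) (Fin n) E).map (algebraMap E E) = ((γ : GL (Fin n) E) : Matrix (Fin n) (Fin n) E) := by
    rw [Algebra.algebraMap_self, RingHom.coe_id, Matrix.map_id]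
  have ha' : Commute (((γ : GL (Fin n) E) : Matrix (Fin n) (Fin n) E).map (algebraMap E E)) (a : Matrix (Fin n) (Fin n) E) := by
    rw [hmap]; exact (congrArg (fun u : GL (Fin n) E => (u : Matrix (Fin n) (Fin n) E)) ha).symm
  have hb' : Commute (((γ : GL (Fin n) E) : Matrix (Fin n) (Fin n) E).map (algebraMap E E)) (b : Matrix (Fin n) (Fin n) E) := by
    rw [hmap]; exact (congrArg (fun u : GL (Fin n) E => (u : Matrix (Fin n) (Fin n) E)) hb).symm
  exact Units.ext (commute_of_commute_map_of_charpoly_separable (K := E) (R := E) _ hγs ha' hb').eq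

/-- **COMPACT SUBGROUPS OF `GL_n(E)` CENTRALISING A RESIDUALLY REGULAR INTEGRAL `γ` ARE INTEGRAL.**  For `γ ∈ GL_n(𝒪)` with separable characteristic
polynomial and separable reduction, every compact subgroup `C ≤ GL_n(E)` with `C ≤ Z(γ)` satisfies `C ≤ GL_n(𝒪)` (Serre's stable lattice for the compact
commutative group `C · (GL_n(𝒪) ∩ Z(γ))`, then the orbit lemma ★ `GLn.mem_glInt_mul_centralizer_of_conj_mem_glInt`).
[cite: SerreAbelianLadic1968, Ch. I §1.1, Remark 1] [cite: Kottwitz1986, Prop. 7.1] [cite: Tits1979, §3.9] -/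
theorem subgroup_le_glInt_of_isCompact_of_le_centralizer [T2Space (GL (Fin n) E)] {γ : GL (Fin n) E} (hγ : γ ∈ glInt n E)
    (hγs : ((γ : GL (Fin n) E) : Matrix (Fin n) (Fin n) E).charpoly.Separable)
    (hsep : (redMat ((γ : GL (Fin n) E) : Matrix (Fin n) (Fin n) E)).charpoly.Separable)
    (C : Subgroup (GL (Fin n) E)) (hC : IsCompact (C : Set (GL (Fin n) E)))
    (hCZ : C ≤ Subgroup.centralizer ({γ} : Set (GL (Fin n) E))) :
    C ≤ glInt n E := by
  -- `K′ = GL_n(𝒪) ∩ Z(γ)`, compact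
  have hK'c : IsCompact ((glInt n E ⊓ Subgroup.centralizer ({γ} : Set (GL (Fin n) E)) : Subgroup (GL (Fin n) E)) : Set (GL (Fin n) E)) := by
    rw [Subgroup.coe_inf]
    exact (isCompact_glInt n E).inter_right (isClosed_coe_centralizer_singleton γ)
  -- `D = C · K′`, a compact subgroup
  obtain ⟨D, hD⟩ := exists_subgroup_coe_eq_mul_of_forall_commute' C (glInt n E ⊓ Subgroup.centralizer ({γ} : Set (GL (Fin n) E)))
    (fun a ha b hb => mul_comm_of_mem_centralizer_of_charpoly_separable' hγs (hCZ ha) (Subgroup.mem_inf.1 hb).2)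
  have hDc : IsCompact (D : Set (GL (Fin n) E)) := by rw [hD]; exact hC.mul hK'c
  haveI : CompactSpace D := isCompact_iff_compactSpace.1 hDc
  have hmemD : ∀ {d : GL (Fin n) E}, d ∈ (C : Set (GL (Fin n) E)) *
      ((glInt n E ⊓ Subgroup.centralizer ({γ} : Set (GL (Fin n) E)) : Subgroup (GL (Fin n) E)) : Set (GL (Fin n) E)) → d ∈ D :=
    fun hd => by rw [← SetLike.mem_coe, hD]; exact hd
  -- Serre: `P⁻¹ D P ⊆ GL_n(𝒪)` (the valuation ring `𝒪[E]` is open; its `GL_n`-range IS ★ `glInt n E` by definition)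
  obtain ⟨P, hP⟩ := Literature.NumberTheory.GaloisRepresentations.exists_conj_mem_range_generalLinearGroup_map_of_valuationSubring
    (O := (valuation E).valuationSubring) Valuation.isOpen_integer
    ({ D.subtype with continuous_toFun := continuous_subtype_val } : D →ₜ* GL (Fin n) E)
  have hP' : ∀ d : GL (Fin n) E, d ∈ D → P⁻¹ * d * P ∈ glInt n E := fun d hd => hP ⟨d, hd⟩
  -- `γ ∈ D`, so `P⁻¹ γ P ∈ GL_n(𝒪)`; the orbit lemma gives `P⁻¹ = k z`
  have hγD : γ ∈ D := hmemD ⟨1, C.one_mem, γ, Subgroup.mem_inf.2 ⟨hγ, Subgroup.mem_centralizer_singleton_iff.2 rfl⟩, one_mul _⟩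
  have hconj : P⁻¹ * γ * P⁻¹⁻¹ ∈ glInt n E := by rw [inv_inv]; exact hP' γ hγD
  obtain ⟨k, hk, z, hz, hkz⟩ := Set.mem_mul.1 (mem_glInt_mul_centralizer_of_conj_mem_glInt hγ hsep P⁻¹ hconj)
  -- conclusion
  intro c hc
  have hcZ : c ∈ Subgroup.centralizer ({γ} : Set (GL (Fin n) E)) := hCZ hc
  have hcD : c ∈ D := hmemD ⟨c, hc, 1, Subgroup.one_mem _, mul_one c⟩
  have h1 : P⁻¹ * c * P ∈ glInt n E := hP' c hcD
  have hPeq : P = z⁻¹ * k⁻¹ := by rw [← _root_.mul_inv_rev, hkz, inv_inv]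
  have h2 : P⁻¹ * c * P = k * c * k⁻¹ := by
    rw [← hkz, hPeq]
    calc k * z * c * (z⁻¹ * k⁻¹) = k * (z * c) * z⁻¹ * k⁻¹ := by simp only [mul_assoc]
      _ = k * (c * z) * z⁻¹ * k⁻¹ := by rw [mul_comm_of_mem_centralizer_of_charpoly_separable' hγs hz hcZ]
      _ = k * c * k⁻¹ := by rw [← mul_assoc k c z, mul_assoc (k * c) z z⁻¹, mul_inv_cancel, mul_one]
  have h3 : c = k⁻¹ * (P⁻¹ * c * P) * k := by rw [h2]; group
  rw [h3]
  exact Subgroup.mul_mem _ (Subgroup.mul_mem _ (Subgroup.inv_mem _ hk) h1) hk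

/-- **`G_γ ∩ GL_n(𝒪) = compactCore G_γ` AT A RESIDUALLY REGULAR INTEGRAL `γ`** — the binder `hcore` of ★ `ResiduallyRegularOrbitalIntegral` (F0P3b-p01 (g5)),
token for token: `⊆` because `Z(γ) ∩ GL_n(𝒪)` is a compact subgroup of the closed `Z(γ)` (★ `preimage_val_subset_compactCore`), `⊇` because every compact
subgroup of `Z(γ)` is integral (`subgroup_le_glInt_of_isCompact_of_le_centralizer`).  With ★ `GLn.forall_exists_mem_glInt_conj_eq_of_isConj` (`hK1`) this
makes ★ `GLn.classOrbitalIntegral_indicator_glInt_eq_one_of_isCanonical` — the unit element `O_γ(1_K) = 1` — hypothesis-free at residually regular `γ`.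
[cite: Kottwitz1986, Prop. 7.1] [cite: Tits1979, §3.9] [cite: Rogawski1990, §4.3 p. 43] -/
theorem setOf_mem_glInt_eq_compactCore_centralizer [T2Space (GL (Fin n) E)] {γ : GL (Fin n) E} (hγ : γ ∈ glInt n E)
    (hγs : ((γ : GL (Fin n) E) : Matrix (Fin n) (Fin n) E).charpoly.Separable)
    (hsep : (redMat ((γ : GL (Fin n) E) : Matrix (Fin n) (Fin n) E)).charpoly.Separable) :
    {z : ↥(Subgroup.centralizer ({γ} : Set (GL (Fin n) E))) | (z : GL (Fin n) E) ∈ glInt n E} =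
      compactCore ↥(Subgroup.centralizer ({γ} : Set (GL (Fin n) E))) := by
  refine Set.Subset.antisymm ?_ (fun z hz => ?_)
  · exact preimage_val_subset_compactCore (Subgroup.centralizer ({γ} : Set (GL (Fin n) E))) (glInt n E)
      (isClosed_coe_centralizer_singleton γ) (isCompact_glInt n E)
  · obtain ⟨K, hK, hzK⟩ := (mem_compactCore_iff z).1 hz
    have hle := subgroup_le_glInt_of_isCompact_of_le_centralizer hγ hγs hsep
      (K.map (Subgroup.centralizer ({γ} : Set (GL (Fin n) E))).subtype)
      (by rw [Subgroup.coe_map]; exact hK.image continuous_subtype_val)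
      (by rw [Subgroup.map_le_iff_le_comap]; intro u _; exact u.2)
    exact hle ⟨z, hzK, rfl⟩

end Literature.NumberTheory.Automorphic.GLn

end
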